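import Summits.Ventures.Crystal3D.Theorems.StickyWulffConstantCoaxialWallLawEndRowCoaxialModuleMenu
import Summits.Ventures.Crystal3D.Theorems.StickyWulffConstantCoaxialWallLawEndRowJointDefs
import Summits.Ventures.Crystal3D.Theorems.StickyWulffConstantCoaxialWallLawEndRowOuterShellSigDefs
import HarnessLib

/-!
# Definitions: ESSENTIAL-RESIDUE TYPES of the off-module tails and the finite fact `TailResidueCert s`
# (crux `CoaxialWallLaw`, stmt-Ventures-19481, line `WallLedgerF`; also T-F2's joint tail)

HONEST FRAMING. Venture `Summits/Ventures/Crystal3D` (cell `crystal3d-full`); DEFINITIONS ONLY for the crux `CoaxialWallLaw`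
(stmt-Ventures-19481, `route-Ventures-StickyWulffConstant`), REGISTERED line `WallLedgerF` (planner cf-p1).  Nothing is claimed;
F-C1 not moved.  cf-p1 DECISION (xci) (2026-08-29T02:32:10Z) on memo HOME/wall-19481-p2/F-TAIL-g9.md §5/§6: the three off-module
tails `EndRow{Trans,Twin,Joint}TailA v2 (2√6) coaxialModuleUniverse` are to close from (i) `…DustDeletion` (inessential balls),
(ii) a TYPE-SOUNDNESS lemma (T4 target, stated here as the Props `TailTypeSoundness{Trans,Twin,Joint}`), and (iii) ONE named finite
fact **`TailResidueCert s`** = cf-p2's T3 tables (PREREG §69 = F-TAIL-g9 §6 verbatim), instance of record `s = 2√6`.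

THE TYPES (decidable data, no subsets of ℝ³):
* module SITES `(i, n, k) ∈ ℤ³` ↦ `modSite (i,n,k) = i•u + n•w + k•(√(2/3) e₃)` (`w` the hole offset; every point of
  `coaxialModule 1 √(2/3)` has this form), with the integer distance form `dsq12` (`= 12·dist²`), the radius-3 site ball `siteBall`
  and the eighteen `menuOffsets` (`dsq12 = 12`);
* `Filler` — (A1) `rigid y a b up`: the edge APEX over the triangle `{y, y+a, y+b}` (`a, b` adjacent menu offsets, both occupied),
  on the side `up` — an EXACT ball (it sits at a slot position of an inclined-twin frame, so it may read); (A2) `loose H`: a ball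
  touching exactly the host sites `H` (one to three) among the exact balls and sitting at no reading position, entering the
  statistic only through its contact TYPE (degrees of the hosts `+1`, its own credited deficiency `10 − #H`); hosts are core
  sites — contacts of loose dust with apexes or junction balls are NOT typed (T4 must dominate them or extend the type);
* `ResidueType` — occupied sites `occ`, a list of `≤ 3` fillers, and an optional JUNCTION datum (inclined mirror index, a site on
  the mirror plane, occupied sites of the reflected grain) — the (B) pilot universe of §6; `WellFormed` (decidable);
  `Realisable` (the real configuration is `1`-separated with the apexes off the module and the loose fillers placeable) — a Prop
  (all data fields are decidable; `Decidable` instances are left to the evaluator file, none is declared here);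
* the DECORATED flat statistic `localStatSigFlatDec P δ κ v Σ z` (degrees `+δ`, pools `+κ`), the realisation `realise τ`, the
  decorations `looseAt τ`, `fillerCredit τ`, and the three rows `statTrans τ ε n`, `statTwin τ ε h`, `statJoint τ`;
* **`TailResidueCert s`** — for every well-formed realisable type all three rows are `≤ s`;
* **`TailTypeSoundnessTrans/Twin/Joint`** — THE T4 TARGET: at every off-module payer window either some deletion of inessential
  balls lands on-site for 𝒰_cx, or the summand is bounded by a row of some well-formed realisable type.  (cf-p1 (xci)(3): the
  bound `k = 3` on fillers is part of THIS lemma, not an article of faith — its docstring names the two admissible proofs.)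
COMPUTABILITY (cf-p1 (xci)(2)): the data are finite and decidable; the rows are defined through the REAL statistic of the
realised decorated window (exact for sites and apexes).  A computable evaluator on the integer model (à la `…EndRowIntModel`)
with an agreement lemma is the planned next file; until then the certificate is cf-p2's exact engine on the same data.
WHAT THIS IS NOT: no certificate, no soundness proof, no tail theorem; F-C1 not moved.
-/

noncomputable section

namespace Summit.Ventures.Crystal3D.Theorems

open Summit.Ventures.Crystal3D Finset
open Literature.MathematicalPhysics.StatisticalMechanics (triangularVec₁ barlowOffset layerNormal)
open scoped InnerProductSpace

namespace TailResidue

/-! ### Module sites (integer data) -/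

/-- The integer distance form on site differences: `12 · dist²` (`…EndRowCoaxialModuleMenu.twelve_mul_dist_sq_module` with `j = 0`). -/
def dsq12 (s t : ℤ × ℤ × ℤ) : ℤ :=
  3 * (2 * (t.1 - s.1) + (t.2.1 - s.2.1)) ^ 2 + (t.2.1 - s.2.1) ^ 2 + 8 * (t.2.2 - s.2.2) ^ 2

/-- The module point of the site `(i, n, k)`: `i•u + n•w + k•(√(2/3) e₃)`. -/
def modSite (s : ℤ × ℤ × ℤ) : EuclideanSpace ℝ (Fin 3) :=
  (s.1 : ℝ) • triangularVec₁ 1 + (s.2.1 : ℝ) • barlowOffset 1 + (s.2.2 : ℝ) • layerNormal (Real.sqrt (2 / 3))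

/-- The sites in the closed ball of radius `3` about the payer site `0` (`12 · 9 = 108`). -/
def siteBall : Finset (ℤ × ℤ × ℤ) :=
  ((Icc (-9 : ℤ) 9) ×ˢ ((Icc (-11 : ℤ) 11) ×ˢ (Icc (-4 : ℤ) 4))).filter fun s => dsq12 (0, 0, 0) s ≤ 108

/-- The eighteen unit menu offsets (`D₊ ∪ D₋`): site differences at distance `1`. -/
def menuOffsets : Finset (ℤ × ℤ × ℤ) :=
  ((Icc (-2 : ℤ) 2) ×ˢ ((Icc (-3 : ℤ) 3) ×ˢ (Icc (-1 : ℤ) 1))).filter fun s => dsq12 (0, 0, 0) s = 12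

/-- Componentwise sum of sites. -/
def addSite (s t : ℤ × ℤ × ℤ) : ℤ × ℤ × ℤ := (s.1 + t.1, s.2.1 + t.2.1, s.2.2 + t.2.2)

/-! ### Fillers and residue types (decidable data) -/

/-- An ESSENTIAL FILLER of a pocket: (A1) a RIGID edge apex over the triangle `{y, y+a, y+b}` on the side `up`, or (A2) a
LOOSE ball touching the host `y` and possibly one further host. -/
inductive Filler
  /-- rigid edge apex over `{y, y + a, y + b}`, side `up` -/
  | rigid (y a b : ℤ × ℤ × ℤ) (up : Bool)
  /-- loose ball touching exactly the (one to three) host sites `H` among the exact balls -/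
  | loose (H : Finset (ℤ × ℤ × ℤ))
  deriving DecidableEq

/-- A filler is well-formed over the occupied set: hosts occupied, one of them within `2` of the payer (`12·4 = 48`) — the filler is
ESSENTIAL; a rigid filler's edge is a pair of ADJACENT occupied menu neighbours of its host; a loose filler has one to three hosts,
pairwise within `2` (they touch one ball). -/
def Filler.WellFormed (occ : Finset (ℤ × ℤ × ℤ)) : Filler → Prop
  | .rigid y a b _ => y ∈ occ ∧ dsq12 (0, 0, 0) y ≤ 48 ∧ a ∈ menuOffsets ∧ b ∈ menuOffsets ∧ dsq12 a b = 12 ∧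
      addSite y a ∈ occ ∧ addSite y b ∈ occ
  | .loose H => H ⊆ occ ∧ 1 ≤ H.card ∧ H.card ≤ 3 ∧ (∃ y ∈ H, dsq12 (0, 0, 0) y ≤ 48) ∧
      ∀ y ∈ H, ∀ t ∈ H, dsq12 y t ≤ 48

/-- The hosts of a filler (the exact balls it touches). -/
def Filler.hosts : Filler → Finset (ℤ × ℤ × ℤ)
  | .rigid y a b _ => {y, addSite y a, addSite y b}
  | .loose H => H

/-- **RESIDUE TYPE**: occupied module sites, at most three essential fillers, an optional junction
(inclined mirror index, a site on the mirror plane, occupied sites of the reflected grain — the (B) pilot universe). -/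
structure ResidueType where
  /-- occupied sites of the module core -/
  occ : Finset (ℤ × ℤ × ℤ)
  /-- essential fillers (≤ 3) -/
  fillers : List Filler
  /-- junction datum: mirror index, plane site, occupied sites of the second grain (preimage sites) -/
  junction : Option (Fin 6 × (ℤ × ℤ × ℤ) × Finset (ℤ × ℤ × ℤ))
  deriving DecidableEq

/-- Well-formedness (decidable): sites in the ball, payer site occupied with `≤ 11` menu contacts, `1`-separation on the module
(`dsq12 ≥ 12`), at most three well-formed fillers, junction sites in the ball. -/
def ResidueType.WellFormed (τ : ResidueType) : Prop :=
  τ.occ ⊆ siteBall ∧ ((0, 0, 0) : ℤ × ℤ × ℤ) ∈ τ.occ ∧ (∀ s ∈ τ.occ, ∀ t ∈ τ.occ, s ≠ t → 12 ≤ dsq12 s t) ∧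
    (τ.occ.filter fun s => dsq12 (0, 0, 0) s = 12).card ≤ 11 ∧ τ.fillers.length ≤ 3 ∧
    (∀ f ∈ τ.fillers, f.WellFormed τ.occ) ∧
    (match τ.junction with
      | none => True
      | some J => J.2.2 ⊆ siteBall ∧ J.2.1 ∈ siteBall)

/-! ### Realisation (real data) -/

/-- The explicit cross product on `ℝ³`. -/
def cross (x y : EuclideanSpace ℝ (Fin 3)) : EuclideanSpace ℝ (Fin 3) :=
  !₂[x 1 * y 2 - x 2 * y 1, x 2 * y 0 - x 0 * y 2, x 0 * y 1 - x 1 * y 0]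

/-- The APEX over the unit triangle `{0, a, b}` on the side `up`: `(a + b)/3 ± (2√2/3)(a × b)` (height `√(2/3)`). -/
def apexVec (a b : EuclideanSpace ℝ (Fin 3)) (up : Bool) : EuclideanSpace ℝ (Fin 3) :=
  (1 / 3 : ℝ) • (a + b) + ((if up then 1 else -1) * (2 * Real.sqrt 2 / 3) : ℝ) • cross a b

/-- The six INCLINED `{111}` mirror planes of the module (three of `D₊`, three of `D₋`), by unit normal: the normalised slot-triangle
sums `(0,4,±1), (−4,4,±1), (4,−8,±1)` (site coordinates; `12·|sum|² = 72`). -/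
def inclinedSum : Fin 6 → ℤ × ℤ × ℤ := ![(0, 4, 1), (-4, 4, 1), (4, -8, 1), (0, 4, -1), (-4, 4, -1), (4, -8, -1)]

/-- The unit normal of the inclined mirror `c`. -/
def inclinedNormal (c : Fin 6) : EuclideanSpace ℝ (Fin 3) := (Real.sqrt 6)⁻¹ • modSite (inclinedSum c)

/-- The reflection across the plane through the point `p` with unit normal `n`. -/
def reflectAt (n p x : EuclideanSpace ℝ (Fin 3)) : EuclideanSpace ℝ (Fin 3) := x - (2 * ⟪x - p, n⟫_ℝ) • n

/-- The realised point of a RIGID filler (the apex); a loose filler has no position. -/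
def Filler.point : Filler → Option (EuclideanSpace ℝ (Fin 3))
  | .rigid y a b up => some (modSite y + apexVec (modSite a) (modSite b) up)
  | .loose _ => none

/-- The exact balls of a type: occupied sites, rigid apexes, and (if any) the reflected second grain. -/
def ResidueType.realise (τ : ResidueType) : Finset (EuclideanSpace ℝ (Fin 3)) :=
  τ.occ.image modSite ∪ (τ.fillers.filterMap Filler.point).toFinset ∪
    (match τ.junction with
      | none => ∅
      | some J => J.2.2.image fun s => reflectAt (inclinedNormal J.1) (modSite J.2.1) (modSite s))

open scoped Classical in
/-- The number of LOOSE fillers touching the point `y` (as a host). -/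
def ResidueType.looseAt (τ : ResidueType) (y : EuclideanSpace ℝ (Fin 3)) : ℕ :=
  (τ.fillers.filter fun f => match f with
    | .loose H => y ∈ H.image modSite
    | .rigid _ _ _ _ => False).length

open scoped Classical in
/-- The CREDITED deficiency brought into the pool of `b` by the loose fillers touching `b`: a filler with `#H` hosts is credited
`10 − #H` (`= 12 − #H − 2`: it touches its hosts and at most the two other fillers). -/
def ResidueType.fillerCredit (τ : ResidueType) (b : EuclideanSpace ℝ (Fin 3)) : ℝ :=
  ((τ.fillers.map fun f => match f with
      | .loose H => if b ∈ H.image modSite then (10 : ℝ) - (H.card : ℝ) else 0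
      | .rigid _ _ _ _ => 0).sum)

/-- **Realisability** (a Prop, not data): the exact balls are `1`-separated, every rigid apex is OFF the module, and every loose
filler admits a position off the module at distance `1` from its hosts and `> 1` from every other exact ball. -/
def ResidueType.Realisable (τ : ResidueType) : Prop :=
  (∀ p ∈ τ.realise, ∀ q ∈ τ.realise, p ≠ q → (1 : ℝ) ≤ dist p q) ∧
  (∀ f ∈ τ.fillers, ∀ x, f.point = some x → x ∉ coaxialModule 1 (Real.sqrt (2 / 3))) ∧
  (∀ f ∈ τ.fillers, ∀ H, f = Filler.loose H →
    ∃ x : EuclideanSpace ℝ (Fin 3), x ∉ coaxialModule 1 (Real.sqrt (2 / 3)) ∧ (∀ h ∈ H, dist x (modSite h) = 1) ∧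
      ∀ p ∈ τ.realise, p ∉ H.image modSite → 1 < dist x p)

/-! ### The decorated flat statistic and the three rows -/

section Dec

variable (P : Finset (EuclideanSpace ℝ (Fin 3))) (δ : EuclideanSpace ℝ (Fin 3) → ℕ) (κ : EuclideanSpace ℝ (Fin 3) → ℝ)

open scoped Classical in
/-- Decorated degree: exact contacts plus loose fillers hosted. -/
def degDec (y : EuclideanSpace ℝ (Fin 3)) : ℕ := (P.filter fun q => dist y q = 1).card + δ y

open scoped Classical in
/-- Decorated two-payer clause: `b` deficient at its decorated degree, or at least two deficient contacts of `b` counting the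
loose fillers touching `b` (each of degree `≤ 5`). -/
def HasTwoPayersDec (b : EuclideanSpace ℝ (Fin 3)) : Prop :=
  degDec P δ b ≤ 11 ∨ 2 ≤ (P.filter fun y => dist b y = 1 ∧ degDec P δ y ≤ 11).card + δ b

open scoped Classical in
/-- Decorated flat pool: deficiencies of the exact payers within `1` of `b` at decorated degrees, the credited deficiency `κ b`
of the loose fillers touching `b`, and the activation unit. -/
def pooledDefFlatDec (b : EuclideanSpace ℝ (Fin 3)) : ℝ :=
  (∑ y ∈ P.filter (fun y => dist b y ≤ 1 ∧ degDec P δ y ≤ 11), ((12 : ℝ) - (degDec P δ y : ℝ))) + κ b +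
    if HasTwoPayersDec P δ b then 0 else 1

open scoped Classical in
/-- **THE DECORATED FLAT STATISTIC** through the signatures `Σ` at the payer `z`: flat signature multiplicities of the EXACT
configuration over decorated flat pools (fillers create no end pairs — part of type soundness). -/
def localStatSigFlatDec (v : WordVersion) (sig : Finset (Bool × EuclideanSpace ℝ (Fin 3))) (z : EuclideanSpace ℝ (Fin 3)) : ℝ :=
  ∑ b ∈ P.filter (fun b => dist z b ≤ 1 ∧ 0 < endMultSigFlat P v sig b),
    (endMultSigFlat P v sig b : ℝ) / pooledDefFlatDec P δ κ b

end Dec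

/-- The translation row `(ε, n)` of a type (version `v2`, payer `0`). -/
def ResidueType.statTrans (τ : ResidueType) (ε : Bool) (n : EuclideanSpace ℝ (Fin 3)) : ℝ :=
  localStatSigFlatDec τ.realise τ.looseAt τ.fillerCredit WordVersion.v2 (transSigs ε n) 0

/-- The twin row `(ε, h)` of a type. -/
def ResidueType.statTwin (τ : ResidueType) (ε : Bool) (h : EuclideanSpace ℝ (Fin 3)) : ℝ :=
  localStatSigFlatDec τ.realise τ.looseAt τ.fillerCredit WordVersion.v2 (twinSigs ε h) 0

/-- The joint row of a type. -/
def ResidueType.statJoint (τ : ResidueType) : ℝ :=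
  localStatSigFlatDec τ.realise τ.looseAt τ.fillerCredit WordVersion.v2 jointSigs 0

/-! ### The finite fact and the type-soundness targets -/

/-- **THE TAIL RESIDUE CERTIFICATE at the line `s`** (cf-p1 (xci)(1); cf-p2 PREREG §69 = F-TAIL-g9 §6): every well-formed,
realisable essential-residue type has all three rows `≤ s` — the `8 + 12 + 1` signature rows of the translation, twin and joint
functionals.  Instance of record `s = 2√6` (certify at a lower line for margin). -/
def TailResidueCert (s : ℝ) : Prop :=
  ∀ τ : ResidueType, τ.WellFormed → τ.Realisable →
    (∀ ε : Bool, ∀ n ∈ modelNormals, τ.statTrans ε n ≤ s) ∧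
    (∀ ε : Bool, ∀ h ∈ basalHexagon, τ.statTwin ε h ≤ s) ∧ τ.statJoint ≤ s

/-- A DELETION WITNESS at the payer `z` of `X`: a sub-configuration keeping `z`, every deleted ball touching no kept ball within
`2` of `z` (`…DustDeletion`), whose window is on-site for 𝒰_cx. -/
def HasDeletionOnSite (X : Finset (EuclideanSpace ℝ (Fin 3))) (z : EuclideanSpace ℝ (Fin 3)) : Prop :=
  ∃ X' ⊆ X, z ∈ X' ∧ (∀ x ∈ X, x ∉ X' → ∀ y ∈ X', dist z y ≤ 2 → dist x y ≠ 1) ∧ OnSiteAt coaxialModuleUniverse X' z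

open scoped Classical in
/-- **TYPE SOUNDNESS, translation row (THE T4 TARGET).**  At every payer window that is NOT on-site for 𝒰_cx: either a deletion of
inessential balls lands on-site, or the translation summand of the frame `L` is bounded by some translation row of some
well-formed realisable type.  (The filler bound `3` of `ResidueType.WellFormed` is discharged INSIDE this lemma: either by
`#essential fillers ≤ 3` or by the monotonicity «a further essential filler only raises decorated degrees of typed hosts»; see
F-TAIL-g9 §5 and cf-p1 (xci)(3).) -/
def TailTypeSoundnessTrans : Prop :=
  ∀ L : EuclideanSpace ℝ (Fin 3) ≃ₗᵢ[ℝ] EuclideanSpace ℝ (Fin 3),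
  ∀ X : Finset (EuclideanSpace ℝ (Fin 3)), (∀ p ∈ X, ∀ q ∈ X, p ≠ q → 1 ≤ dist p q) →
  ∀ z ∈ X, (X.filter fun q => dist z q = 1).card ≤ 11 → ¬ OnSiteAt coaxialModuleUniverse X z →
    HasDeletionOnSite X z ∨ ∃ τ : ResidueType, τ.WellFormed ∧ τ.Realisable ∧ ∃ ε : Bool, ∃ n ∈ modelNormals,
      localSummandA WordVersion.v2 ⟨L, inPlaneRoots L 1⟩ ⟨L, inPlaneRoots L (-1)⟩ X z ≤ τ.statTrans ε n

open scoped Classical in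
/-- **TYPE SOUNDNESS, twin row** (half-turn form): a translation row OR a twin row of some type bounds the twin summand. -/
def TailTypeSoundnessTwin : Prop :=
  ∀ L : EuclideanSpace ℝ (Fin 3) ≃ₗᵢ[ℝ] EuclideanSpace ℝ (Fin 3),
  ∀ X : Finset (EuclideanSpace ℝ (Fin 3)), (∀ p ∈ X, ∀ q ∈ X, p ≠ q → 1 ≤ dist p q) →
  ∀ z ∈ X, (X.filter fun q => dist z q = 1).card ≤ 11 → ¬ OnSiteAt coaxialModuleUniverse X z →
    HasDeletionOnSite X z ∨ ∃ τ : ResidueType, τ.WellFormed ∧ τ.Realisable ∧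
      ((∃ ε : Bool, ∃ n ∈ modelNormals,
        localSummandA WordVersion.v2 ⟨L, inPlaneRoots L 1⟩
          ⟨((ℝ ∙ EuclideanSpace.single (2 : Fin 3) (1 : ℝ)).reflection).trans L,
            inPlaneRoots (((ℝ ∙ EuclideanSpace.single (2 : Fin 3) (1 : ℝ)).reflection).trans L) (-1)⟩ X z ≤ τ.statTrans ε n) ∨
      (∃ ε : Bool, ∃ h ∈ basalHexagon,
        localSummandA WordVersion.v2 ⟨L, inPlaneRoots L 1⟩
          ⟨((ℝ ∙ EuclideanSpace.single (2 : Fin 3) (1 : ℝ)).reflection).trans L,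
            inPlaneRoots (((ℝ ∙ EuclideanSpace.single (2 : Fin 3) (1 : ℝ)).reflection).trans L) (-1)⟩ X z ≤ τ.statTwin ε h))

open scoped Classical in
/-- **TYPE SOUNDNESS, joint row**: a translation row OR the joint row of some type bounds the joint summand. -/
def TailTypeSoundnessJoint : Prop :=
  ∀ L : EuclideanSpace ℝ (Fin 3) ≃ₗᵢ[ℝ] EuclideanSpace ℝ (Fin 3),
  ∀ X : Finset (EuclideanSpace ℝ (Fin 3)), (∀ p ∈ X, ∀ q ∈ X, p ≠ q → 1 ≤ dist p q) →
  ∀ z ∈ X, (X.filter fun q => dist z q = 1).card ≤ 11 → ¬ OnSiteAt coaxialModuleUniverse X z →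
    HasDeletionOnSite X z ∨ ∃ τ : ResidueType, τ.WellFormed ∧ τ.Realisable ∧
      ((∃ ε : Bool, ∃ n ∈ modelNormals,
        localSummandA WordVersion.v2 (basalSystem L)
          (basalSystem (((ℝ ∙ EuclideanSpace.single (2 : Fin 3) (1 : ℝ)).reflection).trans L)) X z ≤ τ.statTrans ε n) ∨
      localSummandA WordVersion.v2 (basalSystem L)
          (basalSystem (((ℝ ∙ EuclideanSpace.single (2 : Fin 3) (1 : ℝ)).reflection).trans L)) X z ≤ τ.statJoint)

end TailResidue

end Summit.Ventures.Crystal3D.Theorems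

end
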